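import Summits.AtomisticToContinuum.HydrodynamicLimit.Theorems.CollisionIsometryCLTAdaptedWeightCLTBlockHDissipation
import Literature.MathematicalPhysics.KineticTheory.HardSphereCampbellAEMeasurable

/-!
# The energy-weighted collision count `collCount` of the line `block-h-dissipation-closure`
# (crux `AdaptedWeightCLT`, stmt-AtomisticToContinuum-14868): bookkeeping on good orbits

Support file (`--supports stmt-AtomisticToContinuum-14868`, helper anchor `bhFewCollisions_count_anchor`) of the
stub worker of `stub_fewCollisions` (S0) of the line lead `prover-line-stmt-AtomisticToContinuum-14868-c4-0`.
It records, for the vocabulary object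

  `collCount σ N Φ t z = Φ.collisionPairSum (Ioc 0 t) (fun _ w i j => if i < j then 1 + ‖vᵢ‖² + ‖vⱼ‖² else 0) z`

(energy-weighted collision count of the orbit of `z` on `(0, t]`, module
`…Theorems.CollisionIsometryCLTAdaptedWeightCLTBlockHDissipation`), the facts the consumers S1 (entropy budget:
Bregman / transport sums) and S2 (Donsker–Varadhan transfer: per-contact error sums) need:

* AUDIT of junk values. `collCount` is a `finsum` over the collision times in `(0, t]`: it is the honest finite
  sum `collCount_eq_finset_sum` whenever these are finitely many — always on the good set `Φ.good`
  (`finite_collisionTimes_Ioc`), which is conull for every local Gibbs law (`ae_mem_good_localGibbsLaw`, tree);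
  off the good set it is junk (`0` if the collision times in `(0, t]` are infinitely many) and no statement of
  the line reads it there. The mark is symmetric and nonnegative (`collMark_nonneg`, `collMark_symm`); in the
  regular torus geometry (`ε_N < 1/2`, i.e. `σ < 1/2`) the ordered contact pairs at a collision time are exactly
  the colliding pair in its two orders, so the `i < j` filter counts each binary collision ONCE, with weight
  `1 + ‖vᵢ‖² + ‖vⱼ‖²` read on the post-collisional velocities — equal to the pre-collisional pair energy
  (`sum_contactPairs_collMark_eq`, `collMark_collidePair`); `collCount` is `≥ 0` (`collCount_nonneg`), vanishes
  for `t ≤ 0` (`collCount_of_nonpos`), is monotone in `t` on good orbits (`collCount_mono`) and dominates the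
  number of collision times in `(0, t]` (`ncard_collisionTimes_le_collCount`).
* MEASURABILITY. `z ↦ collCount σ N Φ t z` is a.e.-measurable for every local Gibbs law
  (`aemeasurable_collCount`): on the good set `ENNReal.ofReal (collCount …)` is the `ℝ≥0∞`-valued collision
  pair sum of the same mark (`ofReal_collCount_eq`), which is Liouville-a.e.-measurable by Alexander's
  collision-by-collision dictionary (tree `aemeasurable_collisionPairSum`, Cercignani–Illner–Pulvirenti 1994
  App. 4.A), and local Gibbs laws are absolutely continuous (`localGibbsLaw_absolutelyContinuous`).

No definitions are introduced (pure proof file).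
-/

namespace Summit.AtomisticToContinuum.HydrodynamicLimit.Theorems.BlockHDissipation

open scoped BigOperators Topology Classical MeasureTheory ENNReal InnerProductSpace
open Filter Set MeasureTheory
open Literature.Analysis.FluidPDE
open Summit.AtomisticToContinuum.HydrodynamicLimit.Theorems.ContactSourceDuhamel (T3 V3 Cfg Vel Flow Flows)
open Summit.AtomisticToContinuum.HydrodynamicLimit.Theorems.ContactSourceDuhamel.TimeLocal
open Literature.MathematicalPhysics.KineticTheory (hsDiameter hsDiameter_le hsDiameter_pos localGibbsLaw
  localGibbsLaw_absolutelyContinuous ae_mem_good_localGibbsLaw aemeasurable_collisionPairSum)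

noncomputable section

namespace FewCollisions

variable {σ : ℝ} {N : ℕ}

/-! ## The mark -/

/-- The mark of `collCount` is nonnegative. -/
theorem collMark_nonneg (w : Cfg N) (i j : Fin (N + 1)) :
    (0 : ℝ) ≤ (if i < j then 1 + ‖(w i).2‖ ^ 2 + ‖(w j).2‖ ^ 2 else 0) := by
  split_ifs <;> positivity

/-- The mark of `collCount` is at most the full pair energy weight `1 + ‖vᵢ‖² + ‖vⱼ‖²`. -/
theorem collMark_le (w : Cfg N) (i j : Fin (N + 1)) :
    (if i < j then 1 + ‖(w i).2‖ ^ 2 + ‖(w j).2‖ ^ 2 else 0 : ℝ) ≤ 1 + ‖(w i).2‖ ^ 2 + ‖(w j).2‖ ^ 2 := by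
  split_ifs
  · exact le_rfl
  · positivity

/-- The pair energy weight is invariant under the elastic involution `collidePair` of the pair (conservation of
the pair kinetic energy): the post-collisional reading of `collCount` equals the pre-collisional one. -/
theorem collMark_collidePair (w : Cfg N) {i j : Fin (N + 1)} (hij : i ≠ j) :
    1 + ‖((collidePair (Torus.geometry (Fin 3)) i j w) i).2‖ ^ 2 +
        ‖((collidePair (Torus.geometry (Fin 3)) i j w) j).2‖ ^ 2 =
      1 + ‖(w i).2‖ ^ 2 + ‖(w j).2‖ ^ 2 := by
  have h := HardSphereCollisionRecord.ofConfig_norm_sq_preVel (Torus.geometry (Fin 3)) (0 : ℝ) w 0 i j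
  rw [HardSphereCollisionRecord.ofConfig_preVel_eq_collidePair (Torus.geometry (Fin 3)) (0 : ℝ) w 0 hij] at h
  simp only [HardSphereCollisionRecord.ofConfig_postVel] at h
  linarith

/-! ## `collCount` as a finite sum on good orbits -/

/-- On the good set the collision times in `(0, t]` are finitely many. -/
theorem finite_collisionTimes_Ioc (Φ : Flow σ N) {z : Cfg N} (hz : z ∈ Φ.good) (t : ℝ) :
    (collisionTimes (Torus.geometry (Fin 3)) (hsDiameter σ N) (fun s => Φ.flow s z) ∩ Ioc 0 t).Finite :=
  Φ.finite_collisionTimes_inter hz Ioc_subset_Icc_self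

/-- `collCount` unfolded: the collision pair sum (tree primitive, curve form) of the mark along the orbit. -/
theorem collCount_eq (Φ : Flow σ N) (t : ℝ) (z : Cfg N) :
    collCount σ N Φ t z = collisionPairSum (Torus.geometry (Fin 3)) (hsDiameter σ N) (fun s => Φ.flow s z)
      (Ioc 0 t) (fun s i j => if i < j then 1 + ‖(Φ.flow s z i).2‖ ^ 2 + ‖(Φ.flow s z j).2‖ ^ 2 else 0) :=
  rfl

/-- **Finite-sum form.** Whenever the collision times in `(0, t]` are finitely many (e.g. on the good set),
`collCount` is the honest finite sum over them of the contact-pair sums of the mark. -/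
theorem collCount_eq_finset_sum (Φ : Flow σ N) (t : ℝ) (z : Cfg N)
    (hfin : (collisionTimes (Torus.geometry (Fin 3)) (hsDiameter σ N) (fun s => Φ.flow s z) ∩ Ioc 0 t).Finite) :
    collCount σ N Φ t z = ∑ s ∈ hfin.toFinset,
      ∑ p ∈ contactPairs (Torus.geometry (Fin 3)) (hsDiameter σ N) (Φ.flow s z),
        (if p.1 < p.2 then 1 + ‖(Φ.flow s z p.1).2‖ ^ 2 + ‖(Φ.flow s z p.2).2‖ ^ 2 else 0 : ℝ) := by
  rw [collCount_eq]
  exact collisionPairSum_eq_finset_sum hfin _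

/-- `0 ≤ collCount` (everywhere, junk included). -/
theorem collCount_nonneg (Φ : Flow σ N) (t : ℝ) (z : Cfg N) : 0 ≤ collCount σ N Φ t z :=
  collisionPairSum_nonneg fun s i j => collMark_nonneg (Φ.flow s z) i j

/-- No window, no collisions: `collCount … t z = 0` for `t ≤ 0`. -/
theorem collCount_of_nonpos (Φ : Flow σ N) {t : ℝ} (ht : t ≤ 0) (z : Cfg N) : collCount σ N Φ t z = 0 := by
  rw [collCount_eq, Ioc_eq_empty (not_lt.2 ht), collisionPairSum_empty]

/-- **Binary collisions.** On a hard-sphere trajectory in the regular torus geometry, at a collision of the pair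
`(p, q)` the contact-pair sum of the mark is the ONE term `1 + ‖v_p‖² + ‖v_q‖²` (the `i < j` filter counts the
collision once). -/
theorem sum_contactPairs_collMark_eq {γ : ℝ → Cfg N}
    (hγ : IsHardSphereTrajectory (Torus.geometry (Fin 3)) (hsDiameter σ N) (N + 1) γ)
    (hG : (Torus.geometry (Fin 3)).IsHardSphereRegular (hsDiameter σ N)) {s : ℝ} {p q : Fin (N + 1)}
    (hpq : (p, q) ∈ contactPairs (Torus.geometry (Fin 3)) (hsDiameter σ N) (γ s)) :
    ∑ e ∈ contactPairs (Torus.geometry (Fin 3)) (hsDiameter σ N) (γ s),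
        (if e.1 < e.2 then 1 + ‖(γ s e.1).2‖ ^ 2 + ‖(γ s e.2).2‖ ^ 2 else 0 : ℝ) =
      1 + ‖(γ s p).2‖ ^ 2 + ‖(γ s q).2‖ ^ 2 := by
  have hne : p ≠ q := (mem_contactPairs.1 hpq).1
  have hne' : (p, q) ≠ (q, p) := fun h => hne (Prod.mk.inj h).1
  rw [hγ.contactPairs_eq_pair hG hpq, Finset.sum_pair hne']
  rcases lt_or_gt_of_ne hne with hlt | hgt
  · rw [if_pos hlt, if_neg (not_lt.2 hlt.le), add_zero]
  · rw [if_neg (not_lt.2 hgt.le), if_pos hgt, zero_add]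
    ring

/-- At a collision time of a trajectory in the regular torus geometry the contact-pair sum of the mark is
`≥ 1`. -/
theorem one_le_sum_contactPairs_collMark {γ : ℝ → Cfg N}
    (hγ : IsHardSphereTrajectory (Torus.geometry (Fin 3)) (hsDiameter σ N) (N + 1) γ)
    (hG : (Torus.geometry (Fin 3)).IsHardSphereRegular (hsDiameter σ N)) {s : ℝ}
    (hs : s ∈ collisionTimes (Torus.geometry (Fin 3)) (hsDiameter σ N) γ) :
    (1 : ℝ) ≤ ∑ e ∈ contactPairs (Torus.geometry (Fin 3)) (hsDiameter σ N) (γ s),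
        (if e.1 < e.2 then 1 + ‖(γ s e.1).2‖ ^ 2 + ‖(γ s e.2).2‖ ^ 2 else 0 : ℝ) := by
  obtain ⟨⟨p, q⟩, hpq⟩ := mem_collisionTimes_iff_contactPairs_nonempty.1 hs
  rw [sum_contactPairs_collMark_eq hγ hG hpq]
  nlinarith [sq_nonneg ‖(γ s p).2‖, sq_nonneg ‖(γ s q).2‖]

/-- **The number of collision times in `(0, t]` is at most `collCount`** (good orbit, `0 ≤ σ < 1/2`). -/
theorem ncard_collisionTimes_le_collCount (hσ : 0 ≤ σ) (hσ' : σ < 2⁻¹) (Φ : Flow σ N) {z : Cfg N}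
    (hz : z ∈ Φ.good) (t : ℝ) :
    ((collisionTimes (Torus.geometry (Fin 3)) (hsDiameter σ N) (fun s => Φ.flow s z) ∩ Ioc 0 t).ncard : ℝ) ≤
      collCount σ N Φ t z := by
  have hfin := finite_collisionTimes_Ioc Φ hz t
  -- regular torus geometry: `ε_N ≤ σ < 1/2` (= `…TimeLocal.FlowDict.regular_hsDiameter`, not imported here)
  have hG : (Torus.geometry (Fin 3)).IsHardSphereRegular (hsDiameter σ N) :=
    Torus.isHardSphereRegular_geometry ((hsDiameter_le hσ N).trans_lt hσ')
  have hγ := Φ.isTrajectory z hz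
  rw [collCount_eq_finset_sum Φ t z hfin, Set.ncard_eq_toFinset_card _ hfin, Finset.card_eq_sum_ones,
    Nat.cast_sum]
  refine Finset.sum_le_sum fun s hs => ?_
  rw [Nat.cast_one]
  exact one_le_sum_contactPairs_collMark hγ hG ((Set.Finite.mem_toFinset hfin).1 hs).1

/-- **Monotonicity of collision pair sums in the window** (curve form): for a nonnegative real summand and
finitely many collision times in the larger window, the collision pair sum over a sub-window is smaller. -/
theorem collisionPairSum_mono_set {γ : ℝ → Cfg N} {S T : Set ℝ} (hST : S ⊆ T)
    (hT : (collisionTimes (Torus.geometry (Fin 3)) (hsDiameter σ N) γ ∩ T).Finite)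
    {g : ℝ → Fin (N + 1) → Fin (N + 1) → ℝ} (hg : ∀ s i j, 0 ≤ g s i j) :
    collisionPairSum (Torus.geometry (Fin 3)) (hsDiameter σ N) γ S g ≤
      collisionPairSum (Torus.geometry (Fin 3)) (hsDiameter σ N) γ T g := by
  have hS : (collisionTimes (Torus.geometry (Fin 3)) (hsDiameter σ N) γ ∩ S).Finite :=
    hT.subset (inter_subset_inter_right _ hST)
  have hD : (collisionTimes (Torus.geometry (Fin 3)) (hsDiameter σ N) γ ∩ (T \ S)).Finite :=
    hT.subset (inter_subset_inter_right _ Set.sdiff_subset)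
  have hunion : S ∪ (T \ S) = T := Set.union_sdiff_cancel hST
  rw [← hunion, collisionPairSum_union hS hD disjoint_sdiff_right]
  exact le_add_of_nonneg_right (collisionPairSum_nonneg hg)

/-- **`collCount` is monotone in `t` on good orbits.** -/
theorem collCount_mono (Φ : Flow σ N) {z : Cfg N} (hz : z ∈ Φ.good) {s t : ℝ} (hst : s ≤ t) :
    collCount σ N Φ s z ≤ collCount σ N Φ t z := by
  rw [collCount_eq, collCount_eq]
  exact collisionPairSum_mono_set (Ioc_subset_Ioc_right hst) (finite_collisionTimes_Ioc Φ hz t)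
    fun r i j => collMark_nonneg (Φ.flow r z) i j

/-! ## The `ℝ≥0∞` reading and measurability -/

/-- The `ℝ≥0∞`-valued mark is measurable in the configuration. -/
theorem measurable_collMark_ennreal (i j : Fin (N + 1)) :
    Measurable fun w : Cfg N =>
      (if i < j then ENNReal.ofReal (1 + ‖(w i).2‖ ^ 2 + ‖(w j).2‖ ^ 2) else 0 : ℝ≥0∞) := by
  by_cases hij : i < j
  · simp only [if_pos hij]
    exact ((measurable_const.add ((measurable_pi_apply i).snd.norm.pow_const 2)).add
      ((measurable_pi_apply j).snd.norm.pow_const 2)).ennreal_ofReal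
  · simp only [if_neg hij]
    exact measurable_const

/-- The `ℝ≥0∞` reading of the mark is `ofReal` of the real mark. -/
theorem collMark_ennreal_eq (w : Cfg N) (i j : Fin (N + 1)) :
    (if i < j then ENNReal.ofReal (1 + ‖(w i).2‖ ^ 2 + ‖(w j).2‖ ^ 2) else 0 : ℝ≥0∞) =
      ENNReal.ofReal (if i < j then 1 + ‖(w i).2‖ ^ 2 + ‖(w j).2‖ ^ 2 else 0) := by
  split_ifs
  · rfl
  · rw [ENNReal.ofReal_zero]

/-- **`ofReal collCount` is the `ℝ≥0∞` collision pair sum of the mark** on good orbits (finitely many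
collision times; `ofReal` of a finite sum of nonnegative reals). -/
theorem ofReal_collCount_eq (Φ : Flow σ N) {z : Cfg N} (hz : z ∈ Φ.good) (t : ℝ) :
    ENNReal.ofReal (collCount σ N Φ t z) = Φ.collisionPairSum (Ioc 0 t)
      (fun _ w i j => (if i < j then ENNReal.ofReal (1 + ‖(w i).2‖ ^ 2 + ‖(w j).2‖ ^ 2) else 0 : ℝ≥0∞)) z := by
  have hfin := finite_collisionTimes_Ioc Φ hz t
  rw [collCount_eq_finset_sum Φ t z hfin]
  unfold HardSphereFlow.collisionPairSum
  rw [collisionPairSum_eq_finset_sum hfin,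
    ENNReal.ofReal_sum_of_nonneg fun s _ => Finset.sum_nonneg fun p _ => collMark_nonneg (Φ.flow s z) p.1 p.2]
  refine Finset.sum_congr rfl fun s _ => ?_
  rw [ENNReal.ofReal_sum_of_nonneg fun p _ => collMark_nonneg (Φ.flow s z) p.1 p.2]
  exact Finset.sum_congr rfl fun p _ => (collMark_ennreal_eq (Φ.flow s z) p.1 p.2).symm

/-- The `ℝ≥0∞` collision pair sum of the mark over `(0, t]` is Liouville-a.e.-measurable (`0 < σ < 1/2`). -/
theorem aemeasurable_collPairSum_ennreal (hσ : 0 < σ) (hσ' : σ < 2⁻¹) (Φ : Flow σ N) (t : ℝ) :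
    AEMeasurable (Φ.collisionPairSum (Ioc 0 t)
      (fun _ w i j => (if i < j then ENNReal.ofReal (1 + ‖(w i).2‖ ^ 2 + ‖(w j).2‖ ^ 2) else 0 : ℝ≥0∞)))
      (liouville (Torus.geometry (Fin 3)) (N + 1) (hsDiameter σ N)) := by
  have hε' : hsDiameter σ N < 1 / 2 := by
    rw [one_div]; exact (hsDiameter_le hσ.le N).trans_lt hσ'
  exact aemeasurable_collisionPairSum (hsDiameter_pos hσ N) hε' Φ _ measurable_collMark_ennreal t

/-- **`ofReal ∘ collCount` is a.e.-measurable for the Liouville measure** (`0 < σ < 1/2`). -/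
theorem aemeasurable_ofReal_collCount_liouville (hσ : 0 < σ) (hσ' : σ < 2⁻¹) (Φ : Flow σ N) (t : ℝ) :
    AEMeasurable (fun z => ENNReal.ofReal (collCount σ N Φ t z))
      (liouville (Torus.geometry (Fin 3)) (N + 1) (hsDiameter σ N)) := by
  refine (aemeasurable_collPairSum_ennreal hσ hσ' Φ t).congr ?_
  filter_upwards [Φ.ae_mem_good] with z hz
  exact (ofReal_collCount_eq Φ hz t).symm

/-- **`ofReal ∘ collCount` is a.e.-measurable for every local Gibbs law** (`0 < σ < 1/2`). -/
theorem aemeasurable_ofReal_collCount (hσ : 0 < σ) (hσ' : σ < 2⁻¹) (a₀ θ₀ : T3 → ℝ) (u₀ : T3 → V3)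
    (Φ : Flow σ N) (t : ℝ) :
    AEMeasurable (fun z => ENNReal.ofReal (collCount σ N Φ t z)) (localGibbsLaw σ a₀ u₀ θ₀ N Φ) :=
  (aemeasurable_ofReal_collCount_liouville hσ hσ' Φ t).mono_ac (localGibbsLaw_absolutelyContinuous σ a₀ u₀ θ₀ N Φ)

/-- **`collCount` is a.e.-measurable for every local Gibbs law** (`0 < σ < 1/2`; real-valued form:
`collCount = toReal (ofReal collCount)` as `collCount ≥ 0`). -/
theorem aemeasurable_collCount (hσ : 0 < σ) (hσ' : σ < 2⁻¹) (a₀ θ₀ : T3 → ℝ) (u₀ : T3 → V3)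
    (Φ : Flow σ N) (t : ℝ) :
    AEMeasurable (fun z => collCount σ N Φ t z) (localGibbsLaw σ a₀ u₀ θ₀ N Φ) := by
  have h := (aemeasurable_ofReal_collCount hσ hσ' a₀ θ₀ u₀ Φ t).ennreal_toReal
  refine h.congr (Eventually.of_forall fun z => ?_)
  exact ENNReal.toReal_ofReal (collCount_nonneg Φ t z)

/-- The event of `FewCollisionsOn` is contained in the `ℝ≥0∞` super-level set of `ofReal ∘ collCount`
(`ofReal` is monotone; no good-set restriction). -/
theorem setOf_lt_collCount_subset (Φ : Flow σ N) (t c : ℝ) :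
    {z : Cfg N | c < collCount σ N Φ t z} ⊆ {z | ENNReal.ofReal c ≤ ENNReal.ofReal (collCount σ N Φ t z)} :=
  fun _ hz => ENNReal.ofReal_le_ofReal (le_of_lt hz)

/-- **Domination by the tree's inline collision mark sum.** On a good orbit, `ofReal (collCount … t z)` is at
most the collision sum over `[0, t]` of the full pair energy weight over ALL ordered contact pairs, in the inline
form `∑ᶠ s ∈ collisionTimes ∩ Icc 0 t, ∑ i, ∑ j, if i ≠ j ∧ ‖xᵢ − xⱼ‖ = ε then b(vᵢ, vⱼ) else 0` consumed by the
tree's mean collision-flux bound `localGibbsLaw_lintegral_le_of_le_collisionMarkSum` (drop the `i < j` filter,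
enlarge `(0, t]` to `[0, t]`). -/
theorem ofReal_collCount_le_markSum (Φ : Flow σ N) {z : Cfg N} (hz : z ∈ Φ.good) (t : ℝ) :
    ENNReal.ofReal (collCount σ N Φ t z) ≤
      ∑ᶠ s ∈ collisionTimes (Torus.geometry (Fin 3)) (hsDiameter σ N) (fun r => Φ.flow r z) ∩ Icc 0 t,
        ∑ i : Fin (N + 1), ∑ j : Fin (N + 1),
          (if i ≠ j ∧ ‖(Torus.geometry (Fin 3)).sepVec (Φ.flow s z i).1 (Φ.flow s z j).1‖ = hsDiameter σ N
            then ENNReal.ofReal (1 + ‖(Φ.flow s z i).2‖ ^ 2 + ‖(Φ.flow s z j).2‖ ^ 2) else 0) := by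
  have hfinI := finite_collisionTimes_Ioc Φ hz t
  have hfinC : (collisionTimes (Torus.geometry (Fin 3)) (hsDiameter σ N) (fun r => Φ.flow r z) ∩ Icc 0 t).Finite :=
    Φ.finite_collisionTimes_inter hz Subset.rfl
  -- the right side is the tree collision pair sum (flow form) of the full weight over `[0, t]`
  rw [← Φ.collisionPairSum_eq_finsum_ite hz (Icc 0 t)
    (fun _ w i j => ENNReal.ofReal (1 + ‖(w i).2‖ ^ 2 + ‖(w j).2‖ ^ 2))]
  -- the left side, in real form, is dominated by the real full-weight sum over `[0, t]`
  have hreal : collCount σ N Φ t z ≤ collisionPairSum (Torus.geometry (Fin 3)) (hsDiameter σ N)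
      (fun r => Φ.flow r z) (Icc 0 t) (fun s i j => 1 + ‖(Φ.flow s z i).2‖ ^ 2 + ‖(Φ.flow s z j).2‖ ^ 2) := by
    rw [collCount_eq]
    refine (collisionPairSum_mono_set Ioc_subset_Icc_self hfinC fun r i j => collMark_nonneg (Φ.flow r z) i j).trans
      (collisionPairSum_mono hfinC fun s _ p _ => collMark_le (Φ.flow s z) p.1 p.2)
  refine (ENNReal.ofReal_le_ofReal hreal).trans (le_of_eq ?_)
  unfold HardSphereFlow.collisionPairSum
  rw [collisionPairSum_eq_finset_sum hfinC, collisionPairSum_eq_finset_sum hfinC,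
    ENNReal.ofReal_sum_of_nonneg fun s _ => Finset.sum_nonneg fun p _ => by positivity]
  refine Finset.sum_congr rfl fun s _ => ?_
  exact ENNReal.ofReal_sum_of_nonneg fun p _ => by positivity

/-- Registration anchor of this helper file (`--supports stmt-AtomisticToContinuum-14868`, helper of
`stub_fewCollisions`): the energy-weighted collision count of the line is a.e.-measurable for every local Gibbs
law, for every `0 < σ < 1/2`, every `N`, every flow and every horizon. -/
theorem bhFewCollisions_count_anchor : ∀ (σ : ℝ), 0 < σ → σ < 2⁻¹ → ∀ (a₀ θ₀ : T3 → ℝ) (u₀ : T3 → V3) (N : ℕ) (Φ : Flow σ N) (t : ℝ), AEMeasurable (fun z => collCount σ N Φ t z) (localGibbsLaw σ a₀ u₀ θ₀ N Φ) :=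
  fun _ hσ hσ' a₀ θ₀ u₀ _ Φ t => aemeasurable_collCount hσ hσ' a₀ θ₀ u₀ Φ t

end FewCollisions

end

end Summit.AtomisticToContinuum.HydrodynamicLimit.Theorems.BlockHDissipation
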